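import Summits.ABC.IUTFork.Cor312Ind3IteratesVacuityWild
import Literature.IUT.LogVolume.UnitLogWildDyadic
import Mathlib.FieldTheory.SplittingField.Construction
import HarnessLib

/-!
# [IUTchIII] Thm 3.11 (ii) (Ind3), honest model: depth `≥ 2` is EMPTY at places `v | 2` with `e(v|2) = 2`, `f(v|2) = 1`
# (abc-iut cell, wave-5 seat abc-iut-w5-d172, gen 2; record-only, D-0012)

S. Mochizuki, *Inter-universal Teichmüller theory III*, kurims manuscript (May 2020), Prop. 3.5 (ii) (a)(b)
pp. 104–105, Rmk. 1.1.1 (i) p. 28 [claim: Mochizuki2012, status: disputed].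

The even prime in the (Ind3) non-vacuity census of abc-iut-w4-d029's honest model of the log-link iterates
(`Cor312Ind3RealIterates`, p412330) for the ANALYTIC logarithms (`Real.analyticLogv`, abc-iut-c312-5).  At
`p_v = 2` the tame criterion `e(v|p_v) ≤ p_v − 1` of p414009 means `e(v|2) = 1` (unramified), and [IUTchI]
Def. 3.1 makes `√−1 ∈ F`, so EVERY place of such `F` over `2` is ramified and p414009 is silent there.  This
PROOF-ONLY file settles the smallest wild case: at every finite place `v | 2` with `e(v|2) = 2` and
`f(v|2) = 1` (e.g. every place over `2` of `ℚ(√−1)`, `ℚ(√2)`, `ℚ(√−2)`; completions `ℚ₂(√−1)`, `ℚ₂(√±2)`, …) the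
honest depth-`≥ 2` (Ind3) iterate images are EMPTY although `e = 2 > p_v − 1 = 1`: classical input
`Literature.IUT.LogVolume.WildDyadic.norm_unitLog_lt_one_of_absRamificationIdx_eq_two_of_residueDegree_eq_one`
(`‖log₂ u‖ ≤ 2^{−1/2}`: the two unit-size terms `x²/2 + x⁴/4` of the logarithmic series cancel modulo `𝔪`
because the residue field is `𝔽₂`; Neukirch ANT II (5.5)), transported by abc-iut-S7's
`absRamificationIdx_rescaledCompletion` / `residueDegree_rescaledCompletion`.

* `Real.analyticLogv_ne_coe_unit_of_dyadic`, **`Real.nonarchIterImage_add_two_eq_empty_of_dyadic`** (+ `_of_two_le`),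
  `Real.not_ramificationIdx_le_of_dyadic` (p414009's hypothesis FAILS there), and the column-level
  `Column.unitImage_add_two_eq_empty_of_honestImages_of_dyadic`.

* **`Real.exists_numberField_dyadic_nonarchIterImage_eq_empty`** — the instance EXISTS at the number-field level:
  `F = ℚ[X]/(g)`, `g` an irreducible factor of `X² − 2` (`[F:ℚ] ≤ 2`, `α² = 2`), and any `v | 2`: `2 ≤ e(v|2)`
  (`‖√2‖ = 2^{−1/2} ≤ 2^{−1/e}`) and `e·f ≤ [F:ℚ] ≤ 2` give `e = 2`, `f = 1`.

Honest framing: statements ABOUT THE MODEL; nothing here asserts or denies [IUTchIII] Cor. 3.12 or takes a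
side; typed ≠ proved; instantiated ≠ endorsed.  No definitions, no Prop-valued fact (D-0067 (1)).
-/

noncomputable section

open Set

namespace Summit.ABC.IUTFork.Thm311.Real

open NumberField IsDedekindDomain Literature.IUT.LogVolume Literature.IUT.LogThetaLattice
  Literature.NumberTheory.NumberFields Polynomial

variable {F : Type} [Field F] [NumberField F]

/-- In the rescaled completion at a place over `p = 2` with `e(v|2) = 2`, `f(v|2) = 1`, every `unitLog` value has
norm `< 1` (`WildDyadic.norm_unitLog_lt_one_…` + abc-iut-S7's `absRamificationIdx_rescaledCompletion`,
`residueDegree_rescaledCompletion`); stated over a prime `p = 2` so that it applies verbatim to the `p_v` of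
`Real.analyticLogv_apply`. [cite: NeukirchANT1999, Ch. II (5.5)] -/
theorem norm_rescaled_unitLog_lt_one_of_dyadic (v : HeightOneSpectrum (𝓞 F)) (p : ℕ) [Fact p.Prime]
    (hv : ((p : ℕ) : 𝓞 F) ∈ v.asIdeal) (hp2 : p = 2) (he : v.asIdeal.ramificationIdx ℤ = 2)
    (hf : v.asIdeal.inertiaDeg ℤ = 1) (x : RescaledCompletion F p v hv) : ‖unitLog x‖ < 1 := by
  subst hp2
  have he' : absRamificationIdx 2 (RescaledCompletion F 2 v hv) = 2 := by
    rw [absRamificationIdx_rescaledCompletion, he]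
  have hf' : residueDegree 2 (RescaledCompletion F 2 v hv) = 1 := by
    rw [residueDegree_rescaledCompletion, hf]
  exact WildDyadic.norm_unitLog_lt_one_of_absRamificationIdx_eq_two_of_residueDegree_eq_one he' hf' x

/-- **At a finite place `v | 2` with `e(v|2) = 2`, `f(v|2) = 1`, the analytic logarithm of a unit is never a unit
of `O_v`.** [cite: NeukirchANT1999, Ch. II (5.5)] -/
theorem analyticLogv_ne_coe_unit_of_dyadic (v : HeightOneSpectrum (𝓞 F))
    (h2 : ((2 : ℕ) : 𝓞 F) ∈ v.asIdeal) (he : v.asIdeal.ramificationIdx ℤ = 2) (hf : v.asIdeal.inertiaDeg ℤ = 1)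
    (w u : (↥(integers v))ˣ) :
    analyticLogv F v (Additive.ofMul w) ≠ ((u : ↥(integers v)) : Carrier (.inr v : Place F)) := by
  haveI : Fact (residueChar F v).Prime := ⟨residueChar_prime F v⟩
  have hp : residueChar F v = 2 := residueChar_eq_of_prime_natCast_mem v Nat.prime_two h2
  intro h
  have h1 : ‖RescaledCompletion.of F (residueChar F v) v (natCast_residueChar_mem F v)
      (analyticLogv F v (Additive.ofMul w))‖ < 1 := by
    rw [analyticLogv_apply, RingEquiv.apply_symm_apply]
    exact norm_rescaled_unitLog_lt_one_of_dyadic v (residueChar F v) (natCast_residueChar_mem F v) hp he hf _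
  rw [h] at h1
  exact h1.ne (norm_of_coe_unit_adicCompletionIntegers F (residueChar F v) v (natCast_residueChar_mem F v) u)

/-- **Depth `≥ 2` is EMPTY at every finite place `v | 2` with `e(v|2) = 2`, `f(v|2) = 1`** — although
`e = 2 > p_v − 1 = 1`, so p414009 does not apply. [claim: Mochizuki2012, status: disputed] -/
theorem nonarchIterImage_add_two_eq_empty_of_dyadic (v : HeightOneSpectrum (𝓞 F))
    (h2 : ((2 : ℕ) : 𝓞 F) ∈ v.asIdeal) (he : v.asIdeal.ramificationIdx ℤ = 2) (hf : v.asIdeal.inertiaDeg ℤ = 1)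
    (k : ℕ) : nonarchIterImage (analyticLogv F) v (k + 2) = ∅ :=
  nonarchIterImage_add_two_eq_empty_of_forall_ne (analyticLogv F) v
    (fun w u => analyticLogv_ne_coe_unit_of_dyadic v h2 he hf w u) k

/-- … for every depth `m′ ≥ 2`. [claim: Mochizuki2012, status: disputed] -/
theorem nonarchIterImage_eq_empty_of_two_le_of_dyadic (v : HeightOneSpectrum (𝓞 F))
    (h2 : ((2 : ℕ) : 𝓞 F) ∈ v.asIdeal) (he : v.asIdeal.ramificationIdx ℤ = 2) (hf : v.asIdeal.inertiaDeg ℤ = 1)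
    {m' : ℕ} (hm' : 2 ≤ m') : nonarchIterImage (analyticLogv F) v m' = ∅ := by
  obtain ⟨k, rfl⟩ := Nat.exists_eq_add_of_le' hm'
  exact nonarchIterImage_add_two_eq_empty_of_dyadic v h2 he hf k

omit [NumberField F] in
/-- The hypothesis `e(v|p_v) ≤ p_v − 1` of p414009 FAILS at such a place (`2 ≤ 1` is false).  [folklore] -/
theorem not_ramificationIdx_le_of_dyadic (v : HeightOneSpectrum (𝓞 F)) (h2 : ((2 : ℕ) : 𝓞 F) ∈ v.asIdeal)
    (he : v.asIdeal.ramificationIdx ℤ = 2) : ¬ v.asIdeal.ramificationIdx ℤ ≤ residueChar F v - 1 := by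
  rw [he, residueChar_eq_of_prime_natCast_mem v Nat.prime_two h2]
  omega

/-- **Column level.** For pilot data `X` and ANY column over `Real.logShellsDH X (analyticLogv F)` with honest
unit images: if some place `w` of `F` over `v_ℚ` has `2 ∈ 𝔭_w`, `e(w|2) = 2`, `f(w|2) = 1`, the unit image at
`(m, m′ + 2, j, v_ℚ)` is `∅`. [claim: Mochizuki2012, status: disputed] -/
theorem _root_.Summit.ABC.IUTFork.Thm311.Column.unitImage_add_two_eq_empty_of_honestImages_of_dyadic
    (X : PilotData F) (C : Column (logShellsDH X (analyticLogv F)))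
    (hunit : ∀ (m : ℤ) (m' : ℕ) (j : (thetaIndex X).Label) (vQ : (thetaIndex X).VQ),
      C.unitImage m m' j vQ =
        (logShellsDH X (analyticLogv F)).tprodImages j vQ (honestU X (analyticLogv F) m m' vQ))
    (m : ℤ) (k : ℕ) (j : (thetaIndex X).Label) {vQ : (thetaIndex X).VQ}
    (w : HeightOneSpectrum (𝓞 F)) (hw : (thetaIndex X).over (.inr w) = vQ)
    (h2 : ((2 : ℕ) : 𝓞 F) ∈ w.asIdeal) (he : w.asIdeal.ramificationIdx ℤ = 2) (hf : w.asIdeal.inertiaDeg ℤ = 1) :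
    C.unitImage m (k + 2) j vQ = ∅ := by
  rw [hunit]
  exact LogShells.tprodImages_eq_empty_of_eq_empty _ j vQ _ ⟨.inr w, hw⟩
    (nonarchIterImage_add_two_eq_empty_of_dyadic w h2 he hf k)


/-! ## F-level existence: `ℚ(√2)` -/

/-- In the rescaled completion at a place over `p = 2`: `x² = 2 ⇒ 2 ≤ e` (`‖x‖² = 1/2`, `‖x‖ < 1 ⇒ ‖x‖ ≤ 2^{−1/e}`).
[cite: NeukirchANT1999, Ch. II (5.5)] -/
theorem two_le_absRamificationIdx_rescaled_of_sq (v : HeightOneSpectrum (𝓞 F)) (p : ℕ) [Fact p.Prime]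
    (hv : ((p : ℕ) : 𝓞 F) ∈ v.asIdeal) (hp2 : p = 2) (x : RescaledCompletion F p v hv) (hx : x ^ 2 = 2) :
    2 ≤ absRamificationIdx p (RescaledCompletion F p v hv) := by
  subst hp2
  have hnorm2 : ‖x‖ ^ 2 = 2⁻¹ := by rw [← norm_pow, hx, WildDyadic.norm_two]
  have hxlt : ‖x‖ < 1 :=
    (pow_lt_one_iff_of_nonneg (norm_nonneg _) (by norm_num : (2 : ℕ) ≠ 0)).mp (by rw [hnorm2]; norm_num)
  have hdisc := norm_le_rpow_of_norm_lt_one 2 (RescaledCompletion F 2 v hv) hxlt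
  set e := absRamificationIdx 2 (RescaledCompletion F 2 v hv) with hedef
  have he0 : (0 : ℝ) < e := by exact_mod_cast absRamificationIdx_pos 2 (RescaledCompletion F 2 v hv)
  have h4 : ‖x‖ ^ 2 ≤ ((2 : ℝ) ^ (-(1 / (e : ℝ)))) ^ 2 := pow_le_pow_left₀ (norm_nonneg _) hdisc 2
  rw [hnorm2, ← Real.rpow_natCast, ← Real.rpow_mul (by norm_num), ← Real.rpow_neg_one,
    Real.rpow_le_rpow_left_iff (by norm_num : (1 : ℝ) < 2)] at h4
  have hege : (2 : ℝ) ≤ e := by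
    have h := mul_le_mul_of_nonneg_right h4 he0.le
    field_simp at h
    push_cast at h
    nlinarith
  exact_mod_cast hege

/-- **`x² = 2` in `K_v` with `2 ∈ 𝔭_v` ⇒ `2 ≤ e(v|2)`.** [cite: NeukirchANT1999, Ch. II (5.5)] -/
theorem two_le_ramificationIdx_of_sq (v : HeightOneSpectrum (𝓞 F)) (h2 : ((2 : ℕ) : 𝓞 F) ∈ v.asIdeal)
    (x : v.adicCompletion F) (hx : x ^ 2 = 2) : 2 ≤ v.asIdeal.ramificationIdx ℤ := by
  have h := two_le_absRamificationIdx_rescaled_of_sq v 2 h2 rfl (RescaledCompletion.of F 2 v h2 x)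
    (by rw [← map_pow, hx, map_ofNat])
  rwa [absRamificationIdx_rescaledCompletion] at h

omit [NumberField F] in
/-- `e(P|ℤ)·f(P|ℤ) ≤ [L : ℚ]` for a nonzero prime of a number field (Mathlib `Ideal.sum_ramification_inertia`;
the tree's `Literature.NumberTheory.NumberFields.ramificationIdx_mul_inertiaDeg_le_finrank` re-proved here to keep
the import light). [folklore] -/
theorem ramificationIdx_mul_inertiaDeg_le_finrank' [NumberField F] (v : HeightOneSpectrum (𝓞 F)) :
    v.asIdeal.ramificationIdx ℤ * v.asIdeal.inertiaDeg ℤ ≤ Module.finrank ℚ F := by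
  classical
  haveI := v.isMaximal
  have hp0 : v.asIdeal.under ℤ ≠ ⊥ := Ideal.under_ne_bot ℤ (Ideal.IsMaximal.ne_bot_of_isIntegral_int v.asIdeal)
  haveI : (v.asIdeal.under ℤ).IsMaximal := Ideal.IsMaximal.under ℤ v.asIdeal
  have hP : v.asIdeal ∈ IsDedekindDomain.primesOverFinset (v.asIdeal.under ℤ) (𝓞 F) :=
    (IsDedekindDomain.mem_primesOverFinset_iff hp0 _).mpr ⟨inferInstance, inferInstance⟩
  rw [← Ideal.ramificationIdx'_eq_ramificationIdx (v.asIdeal.under ℤ) v.asIdeal hp0,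
    ← Ideal.inertiaDeg'_eq_inertiaDeg (v.asIdeal.under ℤ) v.asIdeal,
    ← Ideal.sum_ramification_inertia (𝓞 F) ℚ F hp0, ← Finset.add_sum_erase _ _ hP]
  exact Nat.le_add_right _ _

/-- **`F = ℚ[X]/(g)`, `g` an irreducible factor of `X² − 2`**: a number field of degree `≤ 2` with `α² = 2`. [folklore] -/
theorem exists_numberField_sq_two_finrank_le :
    ∃ (F : Type) (_ : Field F) (_ : NumberField F) (α : F), α ^ 2 = 2 ∧ Module.finrank ℚ F ≤ 2 := by
  let f : ℚ[X] := X ^ 2 - C 2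
  have hf : f.natDegree = 2 := natDegree_X_pow_sub_C
  have hfne : f.natDegree ≠ 0 := by rw [hf]; norm_num
  haveI : Fact (Irreducible f.factor) := ⟨irreducible_factor f⟩
  have hg0 : f.factor ≠ 0 := (irreducible_factor f).ne_zero
  haveI : Module.Finite ℚ (AdjoinRoot f.factor) := (AdjoinRoot.powerBasis hg0).finite
  haveI : CharZero (AdjoinRoot f.factor) :=
    charZero_of_injective_algebraMap (algebraMap ℚ (AdjoinRoot f.factor)).injective
  haveI : NumberField (AdjoinRoot f.factor) := NumberField.mk
  refine ⟨AdjoinRoot f.factor, inferInstance, inferInstance, AdjoinRoot.root f.factor, ?_, ?_⟩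
  · have hdvd : f.factor ∣ f := factor_dvd_of_natDegree_ne_zero hfne
    have halg : algebraMap ℚ (AdjoinRoot f.factor) = AdjoinRoot.of f.factor := Subsingleton.elim _ _
    have hroot : aeval (AdjoinRoot.root f.factor) f.factor = 0 := by
      rw [aeval_def, halg]
      exact AdjoinRoot.eval₂_root f.factor
    have h0 : aeval (AdjoinRoot.root f.factor) f = 0 := aeval_eq_zero_of_dvd_aeval_eq_zero hdvd hroot
    have h1 : aeval (AdjoinRoot.root f.factor) f = AdjoinRoot.root f.factor ^ 2 - 2 := by
      simp [f, map_ofNat]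
    rw [h1, sub_eq_zero] at h0
    exact h0
  · rw [(AdjoinRoot.powerBasis hg0).finrank, AdjoinRoot.powerBasis_dim, ← hf]
    exact natDegree_le_of_dvd (factor_dvd_of_natDegree_ne_zero hfne) (monic_X_pow_sub_C (2 : ℚ) (by norm_num)).ne_zero

/-- **EXISTENCE OF A DYADIC WILD PLACE WITH EMPTY DEPTH `≥ 2`**: there are a number field `F` (`= ℚ(√2)`) and a
finite place `v` with `p_v = 2`, `e(v|2) = 2`, `f(v|2) = 1` — so the hypothesis `e(v|p_v) ≤ p_v − 1` of p414009
FAILS — at which every honest depth-`≥ 2` (Ind3) iterate image for the analytic logarithms is EMPTY.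
[claim: Mochizuki2012, status: disputed] -/
theorem exists_numberField_dyadic_nonarchIterImage_eq_empty :
    ∃ (F : Type) (_ : Field F) (_ : NumberField F) (v : HeightOneSpectrum (𝓞 F)),
      residueChar F v = 2 ∧ v.asIdeal.ramificationIdx ℤ = 2 ∧ v.asIdeal.inertiaDeg ℤ = 1 ∧
        ¬ v.asIdeal.ramificationIdx ℤ ≤ residueChar F v - 1 ∧
          ∀ k : ℕ, nonarchIterImage (analyticLogv F) v (k + 2) = ∅ := by
  obtain ⟨F, _, _, α, hα, hdeg⟩ := exists_numberField_sq_two_finrank_le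
  obtain ⟨v, hv⟩ := exists_heightOneSpectrum_natCast_mem' (F := F) Nat.prime_two
  have hx : (algebraMap F (v.adicCompletion F) α) ^ 2 = 2 := by rw [← map_pow, hα, map_ofNat]
  have h2 : 2 ≤ v.asIdeal.ramificationIdx ℤ := two_le_ramificationIdx_of_sq v hv _ hx
  have hef : v.asIdeal.ramificationIdx ℤ * v.asIdeal.inertiaDeg ℤ ≤ 2 :=
    (ramificationIdx_mul_inertiaDeg_le_finrank' v).trans hdeg
  haveI := v.isPrime
  have hfpos : 0 < v.asIdeal.inertiaDeg ℤ := Ideal.inertiaDeg_pos (R := ℤ) (q := v.asIdeal)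
  have he : v.asIdeal.ramificationIdx ℤ = 2 := by nlinarith
  have hf : v.asIdeal.inertiaDeg ℤ = 1 := by nlinarith
  exact ⟨F, inferInstance, inferInstance, v, residueChar_eq_of_prime_natCast_mem v Nat.prime_two hv, he, hf,
    not_ramificationIdx_le_of_dyadic v hv he, fun k => nonarchIterImage_add_two_eq_empty_of_dyadic v hv he hf k⟩

end Summit.ABC.IUTFork.Thm311.Real

end
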